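import Literature.NumberTheory.GaloisRepresentations.CorestrictionTransitive
import Literature.NumberTheory.GaloisRepresentations.CorestrictionConjInvariant
import HarnessLib

/-!
# Conjugation by the ambient group on the relative induced module `M_V^{S}(M)`, `S = V'.subgroupOf V`:
# the pair `(s ↦ g⁻¹sg, m ↦ g·m)` on `H^q(V'.subgroupOf V, M)`, its comparison with `H^q(V', M)`, and the
# twist `T_g F = g·F(g⁻¹·g)` with `N ∘ T_g = g ∘ N` (part I of the relative `cor`/conjugation compatibility)

Topic `NumberTheory/GaloisRepresentations`; namespace `Literature.NumberTheory.GaloisRepresentations`.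
Definitions with bodies and theorems; no named fact, no instance, no `sorry`. Part II
(`RelativeCorestrictionConj.lean`) draws the cohomological consequence `cor_{V/V'} ∘ (g ·) = (g ·) ∘ cor_{V/V'}`.

SETTING. `Γ` a profinite group, `V' ≤ V ≤ Γ` closed NORMAL subgroups of `Γ` (`[V : V']` finite where a norm
is taken), `M` a discrete `Γ`-module (`ρ`), `g ∈ Γ` — typically `g ∉ V`: the generators `γ₁, γ₂` of a
`ℤ_p²`-tower acting on the cohomology of its layers `V = V_n ⊇ V' = V_{n+1}`. The tree's all-degree
corestriction `cor S σ q` (`Corestriction.lean`, Serre I §2.5) of the profinite group `↥V` along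
`S = V'.subgroupOf V` with coefficients `σ = M|_V` factors through the Shapiro isomorphism of the relative
induced module `M_V^S(M)` (`coindSub V V' ρ` of `CorestrictionTransitive.lean`: continuous `F : V → M` with
`F(s x) = s·F(x)`, `V` acting by `(vF)(x) = F(xv)`) and the norm `N : M_V^S(M) → M`. Here:

* §1 the action of `g` on `H^q(V'.subgroupOf V, M)` as the map of the pair `(s ↦ g⁻¹sg, m ↦ g·m)`
  (`subOfConj`, `subOfConjRepHom`, `conjMapSubOf`), and its compatibility with the tree's action
  `conjMap ρ.toTopRep V' g q` on `H^q(V', M)` through BOTH tautological comparisons — `ofSubgroupOf`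
  (`CorestrictionTransitive.lean`) and `toSubgroupOf` (`ContinuousCorestriction.lean`), which are mutually
  inverse (`ofSubgroupOf_toSubgroupOf`, `toSubgroupOf_ofSubgroupOf`, `ofSubgroupOf_conjMapSubOf`,
  `toSubgroupOf_conjMap`: every composite is the map of one compatible pair, `map_comp_apply_of`);
* §2 the TWIST `(T_g F)(x) = g · F(g⁻¹ x g)` of `M_V^S(M)` (`coindSubConj`; `T_g F ∈ M_V^S(M)` because `g`
  normalises `V'`), as the module half `coindSubConjHom` of the pair `(x ↦ g⁻¹xg, T_g)` over `↥V`, and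
  **`N ∘ T_g = g ∘ N`** (`normCoind_coindSubConjHom`): `Σ_{c ∈ V/S} c̃·g·F(g⁻¹c̃⁻¹g) = g·Σ_c (g⁻¹c̃g)·F((g⁻¹c̃g)⁻¹)
  = g·N(F)`, conjugation by `g` permuting `V ⧸ S` (`quotConj`, `quotConj_bijective`) and the summands
  depending only on the coset (`normTerm_eq_of_coe_eq`).

## References
* J.-P. Serre, *Galois Cohomology* (1997), I §2.5 (induced modules, corestriction). [SerreGaloisCohomology1997]
* J. Neukirch, A. Schmidt, K. Wingberg, *Cohomology of Number Fields* (2008), I §5 Prop. 1.5.4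
  (`cor`, `res` commute with conjugation `σ_*`). [NeukirchSchmidtWingberg2008]
-/

noncomputable section

open CategoryTheory Function

universe u

namespace Literature.NumberTheory.GaloisRepresentations

open _root_.TopRep _root_.ContRepresentation _root_.ContinuousCohomology
open Literature.NumberTheory.EllipticCurves (subgroupConj subgroupConj_apply_coe)

section RelConj

variable {Γ : Type u} [Group Γ] [TopologicalSpace Γ] [IsTopologicalGroup Γ] [CompactSpace Γ]
  [T2Space Γ] [TotallyDisconnectedSpace Γ]
variable (V V' : Subgroup Γ) [hV : IsClosed (V : Set Γ)] [hV' : IsClosed (V' : Set Γ)]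
  [hVn : V.Normal] [hV'n : V'.Normal]
variable {M : Type u} [AddCommGroup M] [TopologicalSpace M] [DiscreteTopology M]
variable (ρ : ContinuousRep Γ ℤ M) (g : Γ)

attribute [local instance] compactSpace_of_isClosed_subgroup discreteTopology_coind
  isClosed_subgroupOf_of_isClosed

/-! ### §1 The action of `g ∈ Γ` on `H^q(V'.subgroupOf V, M)` and the comparison with `H^q(V', M)` -/

omit [CompactSpace Γ] [T2Space Γ] [TotallyDisconnectedSpace Γ] hV hV' in
/-- `g⁻¹ s g ∈ V'.subgroupOf V` for `s ∈ V'.subgroupOf V` (`V'` normal in `Γ`). [cite: NeukirchSchmidtWingberg2008, I §5 Prop. 1.5.4] -/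
theorem conj_mem_subgroupOf (s : (V'.subgroupOf V : Subgroup V)) :
    subgroupConj V g (s : V) ∈ V'.subgroupOf V := by
  rw [Subgroup.mem_subgroupOf, subgroupConj_apply_coe]
  simpa only [inv_inv] using hV'n.conj_mem ((s : V) : Γ) s.2 g⁻¹

/-- **Conjugation `s ↦ g⁻¹ s g` by `g ∈ Γ` on `V'.subgroupOf V ≤ ↥V`**, a continuous homomorphism
(the restriction of the tree's `subgroupConj V g : V →ₜ* V`). [cite: SerreGaloisCohomology1997, I §2.5] -/
def subOfConj : (V'.subgroupOf V : Subgroup V) →ₜ* (V'.subgroupOf V : Subgroup V) where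
  toFun s := ⟨subgroupConj V g (s : V), conj_mem_subgroupOf V V' g s⟩
  map_one' := Subtype.ext (map_one _)
  map_mul' _ _ := Subtype.ext (map_mul _ _ _)
  continuous_toFun :=
    Continuous.subtype_mk ((subgroupConj V g).continuous_toFun.comp continuous_subtype_val) _

omit [CompactSpace Γ] [T2Space Γ] [TotallyDisconnectedSpace Γ] hV hV' in
/-- Unfolding `subOfConj` on underlying elements of `Γ`. [cite: SerreGaloisCohomology1997, I §2.5] -/
@[simp] theorem subOfConj_coe_coe (s : (V'.subgroupOf V : Subgroup V)) :
    (((subOfConj V V' g s : (V'.subgroupOf V : Subgroup V)) : V) : Γ) = g⁻¹ * ((s : V) : Γ) * g :=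
  rfl

/-- The module half `m ↦ g·m : res_{s ↦ g⁻¹sg} (M|_{V'.subgroupOf V}) ⟶ M|_{V'.subgroupOf V}` of the pair
defining the action of `g` on `H^q(V'.subgroupOf V, M)`. [cite: SerreGaloisCohomology1997, I §2.5] -/
def subOfConjRepHom :
    TopRep.res (subOfConj V V' g : (V'.subgroupOf V : Subgroup V) →* (V'.subgroupOf V : Subgroup V))
      (repSub V V' ρ).toTopRep ⟶ (repSub V V' ρ).toTopRep :=
  TopRep.ofHom ⟨(ρ.toTopRep.ρ g : M →L[ℤ] M), fun s => by
    ext m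
    change ρ g (ρ (g⁻¹ * ((s : V) : Γ) * g) m) = ρ ((s : V) : Γ) (ρ g m)
    rw [mul_assoc, map_mul, Module.End.mul_apply, ← Module.End.mul_apply (ρ g), ← map_mul,
      mul_inv_cancel, map_one, Module.End.one_apply, map_mul, Module.End.mul_apply]⟩

omit [CompactSpace Γ] [T2Space Γ] [TotallyDisconnectedSpace Γ] hV hV' in
/-- `subOfConjRepHom` on elements: `m ↦ g·m`. [cite: SerreGaloisCohomology1997, I §2.5] -/
@[simp] theorem subOfConjRepHom_hom_apply (m : M) : (subOfConjRepHom V V' ρ g).hom m = ρ g m := rfl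

/-- **The action of `g ∈ Γ` on `H^q(V'.subgroupOf V, M)`** (the pair `(s ↦ g⁻¹sg, m ↦ g·m)`).
[cite: SerreGaloisCohomology1997, I §2.5] [cite: NeukirchSchmidtWingberg2008, I §5] -/
def conjMapSubOf (q : ℕ) :
    continuousCohomology q (repSub V V' ρ).toTopRep ⟶ continuousCohomology q (repSub V V' ρ).toTopRep :=
  ContinuousCohomology.map (subOfConj V V' g) (subOfConjRepHom V V' ρ g) q


variable (h : V' ≤ V)

/-- The module half `m ↦ g·m` of the pair `(V' → V'.subgroupOf V, v ↦ g⁻¹vg; m ↦ g·m)` computing BOTH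
`ofSubgroupOf ∘ (g ·)` and `(g ·) ∘ ofSubgroupOf`. [cite: SerreGaloisCohomology1997, I §2.5] -/
def ofSubgroupOfConjHom :
    TopRep.res (((toSubgroupOfHom V V' h).comp (subgroupConj V' g) :
        V' →ₜ* (V'.subgroupOf V : Subgroup V)) : V' →* (V'.subgroupOf V : Subgroup V))
      (repSub V V' ρ).toTopRep ⟶ (ρ.restrict (subgroupIncl V')).toTopRep :=
  TopRep.ofHom ⟨(ρ.toTopRep.ρ g : M →L[ℤ] M), fun s => by
    ext m
    change ρ g (ρ (g⁻¹ * (s : Γ) * g) m) = ρ (s : Γ) (ρ g m)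
    rw [mul_assoc, map_mul, Module.End.mul_apply, ← Module.End.mul_apply (ρ g), ← map_mul,
      mul_inv_cancel, map_one, Module.End.one_apply, map_mul, Module.End.mul_apply]⟩

omit [CompactSpace Γ] [T2Space Γ] [TotallyDisconnectedSpace Γ] hV hV' in
/-- **The comparison `H^q(V'.subgroupOf V, M) → H^q(V', M)` is equivariant**:
`ofSubgroupOf (g · z) = g · ofSubgroupOf z` (both are the map of the pair `(v ↦ g⁻¹vg, m ↦ g·m)`).
[cite: NeukirchSchmidtWingberg2008, I §5 Prop. 1.5.4] -/
theorem ofSubgroupOf_conjMapSubOf (q : ℕ) (z : continuousCohomology q (repSub V V' ρ).toTopRep) :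
    ofSubgroupOf V V' ρ h q (conjMapSubOf V V' ρ g q z) =
      conjMap ρ.toTopRep V' g q (ofSubgroupOf V V' ρ h q z) := by
  have h1 : ofSubgroupOf V V' ρ h q (conjMapSubOf V V' ρ g q z) =
      ContinuousCohomology.map ((toSubgroupOfHom V V' h).comp (subgroupConj V' g))
        (ofSubgroupOfConjHom V V' ρ g h) q z :=
    (map_comp_apply_of (X := (repSub V V' ρ).toTopRep) (Y := (repSub V V' ρ).toTopRep)
      (Z := (ρ.restrict (subgroupIncl V')).toTopRep) (subOfConj V V' g) (toSubgroupOfHom V V' h)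
      ((toSubgroupOfHom V V' h).comp (subgroupConj V' g))
      (fun x => Subtype.ext (Subtype.ext rfl)) (subOfConjRepHom V V' ρ g)
      (TopRep.ofHom ⟨ContinuousLinearMap.id ℤ M, fun _ => rfl⟩) (ofSubgroupOfConjHom V V' ρ g h)
      (fun _ => rfl) q z).symm
  have h2 : conjMap ρ.toTopRep V' g q (ofSubgroupOf V V' ρ h q z) =
      ContinuousCohomology.map ((toSubgroupOfHom V V' h).comp (subgroupConj V' g))
        (ofSubgroupOfConjHom V V' ρ g h) q z :=
    (map_comp_apply_of (X := (repSub V V' ρ).toTopRep) (Y := (ρ.restrict (subgroupIncl V')).toTopRep)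
      (Z := (ρ.restrict (subgroupIncl V')).toTopRep) (toSubgroupOfHom V V' h) (subgroupConj V' g)
      ((toSubgroupOfHom V V' h).comp (subgroupConj V' g))
      (fun _ => rfl) (TopRep.ofHom ⟨ContinuousLinearMap.id ℤ M, fun _ => rfl⟩)
      (conjRepHom ρ.toTopRep V' g) (ofSubgroupOfConjHom V V' ρ g h) (fun _ => rfl) q z).symm
  rw [h1, h2]

omit [CompactSpace Γ] [T2Space Γ] [TotallyDisconnectedSpace Γ] hV hV' hVn hV'n in
/-- **`ofSubgroupOf ∘ toSubgroupOf = id`**: the tree's `toSubgroupOf ρ.toTopRep h q : H^q(V', M) →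
H^q(V'.subgroupOf V, M|_V)` (`ContinuousCorestriction.lean`) is a right inverse of `ofSubgroupOf`
(the two comparison homomorphisms `V' ⇄ V'.subgroupOf V` are mutually inverse). [cite: SerreGaloisCohomology1997, I §2.5] -/
theorem ofSubgroupOf_toSubgroupOf (q : ℕ)
    (z : continuousCohomology q (ρ.restrict (subgroupIncl V')).toTopRep) :
    ofSubgroupOf V V' ρ h q (toSubgroupOf ρ.toTopRep h q z) = z := by
  have h1 := map_comp_apply_of (X := (ρ.restrict (subgroupIncl V')).toTopRep)
    (subgroupOfHom h) (toSubgroupOfHom V V' h) (ContinuousMonoidHom.id V')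
    (fun _ => Subtype.ext rfl) (TopRep.ofHom ⟨ContinuousLinearMap.id ℤ M, fun _ => rfl⟩)
    (TopRep.ofHom ⟨ContinuousLinearMap.id ℤ M, fun _ => rfl⟩)
    (𝟙 (ρ.restrict (subgroupIncl V')).toTopRep) (fun _ => rfl) q z
  have h0 : ContinuousCohomology.map (X := (ρ.restrict (subgroupIncl V')).toTopRep)
      (Y := (ρ.restrict (subgroupIncl V')).toTopRep) (ContinuousMonoidHom.id V')
      (𝟙 (ρ.restrict (subgroupIncl V')).toTopRep) q z = z := by
    rw [ContinuousCohomology.map_id (ρ.restrict (subgroupIncl V')).toTopRep q]; rfl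
  exact h1.symm.trans h0

omit [CompactSpace Γ] [T2Space Γ] [TotallyDisconnectedSpace Γ] hV hV' hVn hV'n in
/-- **`toSubgroupOf ∘ ofSubgroupOf = id`.** [cite: SerreGaloisCohomology1997, I §2.5] -/
theorem toSubgroupOf_ofSubgroupOf (q : ℕ) (z : continuousCohomology q (repSub V V' ρ).toTopRep) :
    toSubgroupOf ρ.toTopRep h q (ofSubgroupOf V V' ρ h q z) = z := by
  have h1 := map_comp_apply_of (X := (repSub V V' ρ).toTopRep)
    (toSubgroupOfHom V V' h) (subgroupOfHom h)
    (ContinuousMonoidHom.id (V'.subgroupOf V : Subgroup V))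
    (fun _ => Subtype.ext (Subtype.ext rfl)) (TopRep.ofHom ⟨ContinuousLinearMap.id ℤ M, fun _ => rfl⟩)
    (TopRep.ofHom ⟨ContinuousLinearMap.id ℤ M, fun _ => rfl⟩)
    (𝟙 (repSub V V' ρ).toTopRep) (fun _ => rfl) q z
  have h0 : ContinuousCohomology.map (X := (repSub V V' ρ).toTopRep) (Y := (repSub V V' ρ).toTopRep)
      (ContinuousMonoidHom.id (V'.subgroupOf V : Subgroup V))
      (𝟙 (repSub V V' ρ).toTopRep) q z = z := by
    rw [ContinuousCohomology.map_id (repSub V V' ρ).toTopRep q]; rfl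
  exact h1.symm.trans h0

/-- The module half of the pair `(V'.subgroupOf V → V', s ↦ g⁻¹sg; m ↦ g·m)` computing
`toSubgroupOf ∘ (g ·)` and `(g ·) ∘ toSubgroupOf`. [cite: SerreGaloisCohomology1997, I §2.5] -/
def toSubgroupOfConjHom :
    TopRep.res (((subgroupOfHom h).comp (subOfConj V V' g) :
        (V'.subgroupOf V : Subgroup V) →ₜ* V') : (V'.subgroupOf V : Subgroup V) →* V')
      (ρ.restrict (subgroupIncl V')).toTopRep ⟶ (repSub V V' ρ).toTopRep :=
  TopRep.ofHom ⟨(ρ.toTopRep.ρ g : M →L[ℤ] M), fun s => by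
    ext m
    change ρ g (ρ (g⁻¹ * ((s : V) : Γ) * g) m) = ρ ((s : V) : Γ) (ρ g m)
    rw [mul_assoc, map_mul, Module.End.mul_apply, ← Module.End.mul_apply (ρ g), ← map_mul,
      mul_inv_cancel, map_one, Module.End.one_apply, map_mul, Module.End.mul_apply]⟩

omit [CompactSpace Γ] [T2Space Γ] [TotallyDisconnectedSpace Γ] hV hV' in
/-- **`toSubgroupOf` is equivariant**: `toSubgroupOf (g · z) = g · toSubgroupOf z`.
[cite: NeukirchSchmidtWingberg2008, I §5 Prop. 1.5.4] -/
theorem toSubgroupOf_conjMap (q : ℕ) (z : continuousCohomology q (ρ.restrict (subgroupIncl V')).toTopRep) :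
    toSubgroupOf ρ.toTopRep h q (conjMap ρ.toTopRep V' g q z) =
      conjMapSubOf V V' ρ g q (toSubgroupOf ρ.toTopRep h q z) := by
  have h1 : toSubgroupOf ρ.toTopRep h q (conjMap ρ.toTopRep V' g q z) =
      ContinuousCohomology.map ((subgroupOfHom h).comp (subOfConj V V' g))
        (toSubgroupOfConjHom V V' ρ g h) q z :=
    (map_comp_apply_of (X := (ρ.restrict (subgroupIncl V')).toTopRep)
      (Y := (ρ.restrict (subgroupIncl V')).toTopRep) (Z := (repSub V V' ρ).toTopRep)
      (subgroupConj V' g) (subgroupOfHom h)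
      ((subgroupOfHom h).comp (subOfConj V V' g))
      (fun _ => Subtype.ext rfl) (conjRepHom ρ.toTopRep V' g)
      (TopRep.ofHom ⟨ContinuousLinearMap.id ℤ M, fun _ => rfl⟩) (toSubgroupOfConjHom V V' ρ g h)
      (fun _ => rfl) q z).symm
  have h2 : conjMapSubOf V V' ρ g q (toSubgroupOf ρ.toTopRep h q z) =
      ContinuousCohomology.map ((subgroupOfHom h).comp (subOfConj V V' g))
        (toSubgroupOfConjHom V V' ρ g h) q z :=
    (map_comp_apply_of (X := (ρ.restrict (subgroupIncl V')).toTopRep) (Y := (repSub V V' ρ).toTopRep)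
      (Z := (repSub V V' ρ).toTopRep) (subgroupOfHom h) (subOfConj V V' g)
      ((subgroupOfHom h).comp (subOfConj V V' g))
      (fun _ => rfl) (TopRep.ofHom ⟨ContinuousLinearMap.id ℤ M, fun _ => rfl⟩)
      (subOfConjRepHom V V' ρ g) (toSubgroupOfConjHom V V' ρ g h) (fun _ => rfl) q z).symm
  rw [h1, h2]


/-! ### §2 The twist `T_g F = g·F(g⁻¹·g)` of the relative induced module `M_V^{S}(M)`, `S = V'.subgroupOf V` -/

/-- **The twist `(T_g F)(x) = g · F(g⁻¹ x g)`** on the induced module `M_V^S(M|_S)` (`S = V'.subgroupOf V`)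
of the profinite group `↥V`, for `g ∈ Γ` normalising `V` and `V'` — `T_g F` is again `S`-equivariant
because `g⁻¹ S g = S`. [cite: SerreGaloisCohomology1997, I §2.5] -/
def coindSubConj : coindModule (repSub V V' ρ) →ₗ[ℤ] coindModule (repSub V V' ρ) where
  toFun F := ⟨((ρ.toTopRep.ρ g : M →L[ℤ] M) : C(M, M)).comp
      ((F : C(V, M)).comp ⟨subgroupConj V g, (subgroupConj V g).continuous_toFun⟩), fun s x => by
    change ρ g ((F : C(V, M)) (subgroupConj V g ((s : V) * x))) =
      ρ (((s : V) : Γ)) (ρ g ((F : C(V, M)) (subgroupConj V g x)))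
    have key := (mem_coind_iff (repSub V V' ρ) (F : C(V, M))).1 F.2 (subOfConj V V' g s)
      (subgroupConj V g x)
    change (F : C(V, M)) ((subgroupConj V g (s : V)) * subgroupConj V g x) =
      ρ (((subgroupConj V g (s : V) : V) : Γ)) ((F : C(V, M)) (subgroupConj V g x)) at key
    rw [map_mul, key, subgroupConj_apply_coe, ← Module.End.mul_apply, ← map_mul,
      ← Module.End.mul_apply, ← map_mul]
    congr 2
    group⟩
  map_add' F F' := Subtype.ext (ContinuousMap.ext fun x => map_add (ρ g) _ _)
  map_smul' c F := Subtype.ext (ContinuousMap.ext fun x => map_zsmul (ρ g) c _)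

omit [CompactSpace Γ] [T2Space Γ] [TotallyDisconnectedSpace Γ] hV hV' in
/-- Unfolding the twist: `(T_g F)(x) = g · F(g⁻¹ x g)`. [cite: SerreGaloisCohomology1997, I §2.5] -/
@[simp] theorem coindSubConj_coe_apply (F : coindModule (repSub V V' ρ)) (x : V) :
    ((coindSubConj V V' ρ g F : coindModule (repSub V V' ρ)) : C(V, M)) x =
      ρ g ((F : C(V, M)) (subgroupConj V g x)) := rfl

/-- **`T_g` as the module half of the pair `(x ↦ g⁻¹xg, T_g)` on `M_V^S(M)`**: a morphism
`res_{c_g} M_V^S(M) ⟶ M_V^S(M)` (`T_g((g⁻¹xg)·F) = x·T_g F` for the action `(vF)(y) = F(yv)`).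
[cite: SerreGaloisCohomology1997, I §2.5] -/
def coindSubConjHom :
    TopRep.res (subgroupConj V g : V →* V) (coindSub V V' ρ).toTopRep ⟶ (coindSub V V' ρ).toTopRep :=
  TopRep.ofHom
    { toLinearMap := coindSubConj V V' ρ g
      cont := continuous_of_discreteTopology
      isIntertwining' := fun x => by
        ext F y
        change ρ g ((((coindSub V V' ρ) (subgroupConj V g x) F : coindModule (repSub V V' ρ)) : C(V, M))
            (subgroupConj V g y)) =
          (((coindSub V V' ρ) x (coindSubConj V V' ρ g F) : coindModule (repSub V V' ρ)) : C(V, M)) y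
        rw [coindRep_apply_apply, coindRep_apply_apply, coindSubConj_coe_apply, map_mul (subgroupConj V g) y x] }

omit [T2Space Γ] [TotallyDisconnectedSpace Γ] hV' in
/-- `coindSubConjHom` on elements. [cite: SerreGaloisCohomology1997, I §2.5] -/
@[simp] theorem coindSubConjHom_hom_coe_apply (F : coindModule (repSub V V' ρ)) (x : V) :
    (((coindSubConjHom V V' ρ g).hom F : coindModule (repSub V V' ρ)) : C(V, M)) x =
      ρ g ((F : C(V, M)) (subgroupConj V g x)) := rfl


omit [CompactSpace Γ] [T2Space Γ] [TotallyDisconnectedSpace Γ] hV hV' in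
/-- `g⁻¹ x g ∈ V'.subgroupOf V ⟹ x ∈ V'.subgroupOf V` (`V'` normal in `Γ`). [cite: NeukirchSchmidtWingberg2008, I §5 Prop. 1.5.4] -/
theorem mem_subgroupOf_of_conj_mem {x : V} (hx : subgroupConj V g x ∈ V'.subgroupOf V) :
    x ∈ V'.subgroupOf V := by
  rw [Subgroup.mem_subgroupOf] at hx ⊢
  rw [subgroupConj_apply_coe] at hx
  have h' := hV'n.conj_mem _ hx g
  rwa [show g * (g⁻¹ * (x : Γ) * g) * g⁻¹ = (x : Γ) by group] at h'

/-- **Conjugation by `g` permutes the cosets `V ⧸ S`** (`S = V'.subgroupOf V`): `vS ↦ (g⁻¹vg)S`.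
[cite: SerreGaloisCohomology1997, I §2.5] -/
def quotConj : V ⧸ (V'.subgroupOf V) → V ⧸ (V'.subgroupOf V) :=
  Quotient.map' (subgroupConj V g) fun a b hab => by
    rw [QuotientGroup.leftRel_apply] at hab ⊢
    rw [← map_inv, ← map_mul]
    exact conj_mem_subgroupOf V V' g ⟨a⁻¹ * b, hab⟩

omit [CompactSpace Γ] [T2Space Γ] [TotallyDisconnectedSpace Γ] hV hV' in
/-- `quotConj` on cosets. [cite: NeukirchSchmidtWingberg2008, I §5 Prop. 1.5.4] -/
theorem quotConj_mk (a : V) :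
    quotConj V V' g (a : V ⧸ (V'.subgroupOf V)) = ((subgroupConj V g a : V) : V ⧸ (V'.subgroupOf V)) :=
  rfl

omit [CompactSpace Γ] [T2Space Γ] [TotallyDisconnectedSpace Γ] hV hV' in
/-- `quotConj` is injective (hence bijective on the finite set `V ⧸ S`). [cite: NeukirchSchmidtWingberg2008, I §5 Prop. 1.5.4] -/
theorem quotConj_injective : Injective (quotConj V V' g) := by
  intro c d hcd
  induction c using QuotientGroup.induction_on with
  | H a =>
    induction d using QuotientGroup.induction_on with
    | H b =>
      rw [quotConj_mk, quotConj_mk, QuotientGroup.eq] at hcd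
      rw [QuotientGroup.eq]
      rw [← map_inv, ← map_mul] at hcd
      exact mem_subgroupOf_of_conj_mem V V' g hcd

omit [CompactSpace Γ] [T2Space Γ] [TotallyDisconnectedSpace Γ] hV hV' in
/-- `quotConj` is bijective when `V ⧸ S` is finite. [cite: NeukirchSchmidtWingberg2008, I §5 Prop. 1.5.4] -/
theorem quotConj_bijective [Finite (V ⧸ (V'.subgroupOf V))] : Bijective (quotConj V V' g) :=
  Finite.injective_iff_bijective.mp (quotConj_injective V V' g)

omit [T2Space Γ] [TotallyDisconnectedSpace Γ] hV' in
/-- The summands of the norm of `T_g F`: `y·(T_gF)(y⁻¹) = g·((g⁻¹yg)·F((g⁻¹yg)⁻¹))`. [cite: SerreGaloisCohomology1997, I §2.5] -/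
theorem normTerm_coindSubConjHom (F : coindModule (repSub V V' ρ)) (y : V) :
    normTerm (S := V'.subgroupOf V) (ρ.restrict (subgroupIncl V)) ((coindSubConjHom V V' ρ g).hom F) y =
      ρ g (normTerm (S := V'.subgroupOf V) (ρ.restrict (subgroupIncl V)) F (subgroupConj V g y)) := by
  unfold normTerm
  change ρ ((y : Γ)) (ρ g ((F : C(V, M)) (subgroupConj V g y⁻¹))) =
    ρ g (ρ (((subgroupConj V g y : V) : Γ)) ((F : C(V, M)) (subgroupConj V g y)⁻¹))
  rw [map_inv, ← Module.End.mul_apply, ← map_mul, ← Module.End.mul_apply, ← map_mul,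
    subgroupConj_apply_coe]
  congr 2
  group

omit [T2Space Γ] [TotallyDisconnectedSpace Γ] hV' in
/-- **`N ∘ T_g = g ∘ N`**: the norm `M_V^S(M) → M` intertwines the twist with the action of `g` on
`M` — `Σ_{c ∈ V/S} c̃·g·F(g⁻¹c̃⁻¹g) = g·Σ_c (g⁻¹c̃g)·F((g⁻¹c̃g)⁻¹) = g·N(F)`, conjugation by `g`
permuting `V ⧸ S`. [cite: SerreGaloisCohomology1997, I §2.5] [cite: NeukirchSchmidtWingberg2008, I §5 Prop. 1.5.4] -/
theorem normCoind_coindSubConjHom [Fintype (V ⧸ (V'.subgroupOf V))] (F : coindModule (repSub V V' ρ)) :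
    (normCoind (S := V'.subgroupOf V) (ρ.restrict (subgroupIncl V))).hom
        ((coindSubConjHom V V' ρ g).hom F) =
      ρ g ((normCoind (S := V'.subgroupOf V) (ρ.restrict (subgroupIncl V))).hom F) := by
  change ∑ c : V ⧸ (V'.subgroupOf V), normTerm (S := V'.subgroupOf V) (ρ.restrict (subgroupIncl V))
      ((coindSubConjHom V V' ρ g).hom F) c.out =
    ρ g (∑ c : V ⧸ (V'.subgroupOf V), normTerm (S := V'.subgroupOf V) (ρ.restrict (subgroupIncl V)) F c.out)
  rw [Finset.sum_congr rfl fun c _ => normTerm_coindSubConjHom V V' ρ g F c.out, ← map_sum]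
  congr 1
  refine Fintype.sum_bijective (quotConj V V' g) (quotConj_bijective V V' g) _ _ fun c => ?_
  exact normTerm_eq_of_coe_eq _ F (by rw [QuotientGroup.out_eq', ← quotConj_mk, QuotientGroup.out_eq'])


end RelConj

end Literature.NumberTheory.GaloisRepresentations

end
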